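import Summits.AnomalousDissipation.AnomalousDissipation.Theorems.SoloBlindSweptGalileanWeak

/-!
# Solo (blind) — Galilean covariance of torus Leray–Hopf solutions for UNIFORMLY SWEPT forces

Second of three files closing the momentum leaf `ZerothLaw ↔ TranslatingZerothLaw₀'`. On top of the weak
formulation (`isWeakNSSolutionForcedOn_galilean_swept`, file `SoloBlindSweptGalileanWeak`) the whole
Leray–Hopf class is transported: if `u` is a (global) Leray–Hopf solution with the force `(t, y) ↦ f (y + [tW])`
(`f` smooth, mean zero; time-zero slice normalised to the datum), then `(t, y) ↦ u t (y + [tV]) − V` is one with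
the force `(t, y) ↦ f (y + [t(W + V)])` from the datum `u₀ − V` (`isLerayHopfOn_galilean_swept`,
`isGlobalLerayHopf_galilean_swept`); with `V = −W` one is back to the STEADY force (`isGlobalLerayHopf_unsweep`).

* energy class (any force; the tree's proofs for `galilean_energy_bound` / `_memLp` / `_memL2Sobolev` do not use
  the force): `galilean_energy_bound_anyForce`, `galilean_memLp_anyForce`, `galilean_memL2Sobolev_anyForce`,
  `setLIntegral_eGradNormSq_galilean_anyForce`;
* momentum is conserved under a swept mean-zero force when paired with constants (`inner_integral_eq_of_swept`,
  from `Torus.IsLerayHopfOn.integral_inner_const_eq`), the work is frame independent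
  (`intervalIntegral_work_swept`), so both energy inequalities move by the constant `−⟪∫ u, V⟫ + ½‖V‖²` on both
  sides (`galilean_energy_ineq_zero_swept`, `galilean_energy_ineq_ae_swept`);
* the continuity clauses are the tree's `weak_continuous_comp_add_path` / `strong_initial_comp_add_path`.

[cite: Frisch1995, §2.2 (Galilean invariance of Navier–Stokes on the periodic box)] [folklore]
-/

noncomputable section

open MeasureTheory Set Filter Topology
open scoped InnerProductSpace RealInnerProductSpace ENNReal NNReal ContDiff

namespace Summit.AnomalousDissipation.AnomalousDissipation.Theorems

open Literature.Analysis.FunctionSpaces Literature.Analysis.FunctionSpaces.Torus UnitAddTorus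
open Literature.Analysis.FluidPDE Literature.Analysis.FluidPDE.Torus

variable {d : Type*} [Fintype d] [DecidableEq d]

/-! ### The energy class in the moving frame (any force) -/

section EnergyClass

variable {T ν : ℝ} {F : ℝ → UnitAddTorus d → EuclideanSpace ℝ d} {f : UnitAddTorus d → EuclideanSpace ℝ d}
  {u₀ : UnitAddTorus d → EuclideanSpace ℝ d} {u : ℝ → UnitAddTorus d → EuclideanSpace ℝ d}

/-- **`L^∞(0,T; L²)` bound in the moving frame** (any force): `∫⁻ ‖u t (· + [tV]) − V‖ₑ² ≤ 2C + 2‖V‖²` for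
a.e. `t ∈ (0, T)` (the tree's `galilean_energy_bound`, whose proof does not use the force). [folklore] -/
theorem galilean_energy_bound_anyForce (h : Torus.IsLerayHopfOn T ν F u₀ u) (V : EuclideanSpace ℝ d) :
    ∃ C : ℝ≥0, ∀ᵐ t ∂(volume.restrict (Ioo 0 T)),
      ∫⁻ y, ‖u t (y + proj (t • V)) - V‖ₑ ^ 2 ≤ C := by
  obtain ⟨C, hC⟩ := h.energy_bound
  refine ⟨2 * C + 2 * ‖V‖₊ ^ 2, ?_⟩
  filter_upwards [hC] with t ht
  calc ∫⁻ y, ‖u t (y + proj (t • V)) - V‖ₑ ^ 2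
      ≤ 2 * (∫⁻ y, ‖u t y‖ₑ ^ 2) + 2 * ‖V‖ₑ ^ 2 := lintegral_enorm_sq_comp_add_right_sub_const_le (u t) _ V
    _ ≤ 2 * (C : ℝ≥0∞) + 2 * ‖V‖ₑ ^ 2 := by gcongr
    _ = ((2 * C + 2 * ‖V‖₊ ^ 2 : ℝ≥0) : ℝ≥0∞) := by
        rw [ENNReal.coe_add, ENNReal.coe_mul, ENNReal.coe_mul, ENNReal.coe_pow, ENNReal.coe_ofNat,
          enorm_eq_nnnorm]

/-- **Every slice in the moving frame is in `L²`** (any force). [folklore] -/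
theorem galilean_memLp_anyForce (h : Torus.IsLerayHopfOn T ν F u₀ u) (V : EuclideanSpace ℝ d) :
    ∀ t ∈ Icc 0 T, MemLp (fun y => u t (y + proj (t • V)) - V) 2 volume :=
  fun t ht => memLp_comp_add_right_sub_const (h.memLp t ht) _ V

/-- **The field in the moving frame lies in `L²(0,T; H¹)`** (any force; the tree's `galilean_memL2Sobolev`).
[folklore] -/
theorem galilean_memL2Sobolev_anyForce (h : Torus.IsLerayHopfOn T ν F u₀ u) (V : EuclideanSpace ℝ d) :
    MemL2Sobolev 0 T 1 (fun t => EuclideanSpace.complexify ∘ fun y => u t (y + proj (t • V)) - V) := by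
  obtain ⟨hae, hfin⟩ := h.memL2Sobolev
  refine ⟨?_, ?_⟩
  · filter_upwards [hae] with t ht
    exact memSobolev_complexify_comp_add_right_sub_const ht _ V
  · unfold eL2SobolevNorm at hfin ⊢
    rw [ENNReal.rpow_lt_top_iff_of_pos (by norm_num)] at hfin ⊢
    have hb : ∀ᵐ t ∂(volume.restrict (Ioo 0 T)),
        eSobolevNorm 1 (EuclideanSpace.complexify ∘ fun y => u t (y + proj (t • V)) - V) ^ 2 ≤
          2 * eSobolevNorm 1 (EuclideanSpace.complexify ∘ u t) ^ 2 +
            2 * ‖EuclideanSpace.complexify V‖ₑ ^ 2 := by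
      filter_upwards [hae] with t ht
      exact eSobolevNorm_one_complexify_comp_add_right_sub_const_sq_le ht _ V
    calc ∫⁻ t in Ioo 0 T, eSobolevNorm 1 (EuclideanSpace.complexify ∘
            fun y => u t (y + proj (t • V)) - V) ^ 2
        ≤ ∫⁻ t in Ioo 0 T, (2 * eSobolevNorm 1 (EuclideanSpace.complexify ∘ u t) ^ 2 +
            2 * ‖EuclideanSpace.complexify V‖ₑ ^ 2) := lintegral_mono_ae hb
      _ = 2 * (∫⁻ t in Ioo 0 T, eSobolevNorm 1 (EuclideanSpace.complexify ∘ u t) ^ 2) +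
            2 * ‖EuclideanSpace.complexify V‖ₑ ^ 2 * volume (Ioo (0 : ℝ) T) := by
          rw [lintegral_add_right _ measurable_const, lintegral_const_mul' _ _ ENNReal.ofNat_ne_top,
            lintegral_const, Measure.restrict_apply_univ]
      _ < ⊤ := ENNReal.add_lt_top.2 ⟨ENNReal.mul_lt_top (by simp) hfin,
            ENNReal.mul_lt_top (ENNReal.mul_lt_top (by simp) (ENNReal.pow_lt_top enorm_lt_top))
              measure_Ioo_lt_top⟩

/-- **The dissipation is frame independent** (any force): `∫ₛᵗ ‖∇(u τ (· + [τV]) − V)‖₂² = ∫ₛᵗ ‖∇u τ‖₂²`,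
`0 ≤ s`, `t ≤ T`. [folklore] -/
theorem setLIntegral_eGradNormSq_galilean_anyForce (h : Torus.IsLerayHopfOn T ν F u₀ u)
    (V : EuclideanSpace ℝ d) {s t : ℝ} (hs : 0 ≤ s) (ht : t ≤ T) :
    ∫⁻ τ in Ioo s t, eGradNormSq (fun y => u τ (y + proj (τ • V)) - V) =
      ∫⁻ τ in Ioo s t, eGradNormSq (u τ) := by
  refine setLIntegral_congr_fun measurableSet_Ioo fun τ hτ => ?_
  exact eGradNormSq_comp_add_right_sub_const
    ((h.memLp τ ⟨hs.trans hτ.1.le, hτ.2.le.trans ht⟩).integrable one_le_two) _ _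

end EnergyClass

/-! ### Momentum, work and the energy inequalities in the moving frame, swept force -/

section Swept

variable {T ν : ℝ} {f : UnitAddTorus d → EuclideanSpace ℝ d}
  {u₀ : UnitAddTorus d → EuclideanSpace ℝ d} {u : ℝ → UnitAddTorus d → EuclideanSpace ℝ d}

/-- **Momentum is conserved under a uniformly swept mean-zero force**, paired with a constant vector:
`⟪∫ u t, V⟫ = ∫ ⟪u₀, V⟫` for `t ∈ (0, T]` (`Torus.IsLerayHopfOn.integral_inner_const_eq`; every force
slice `f (· + [sW])` pairs to zero with constants). [folklore] -/
theorem inner_integral_eq_of_swept (W : EuclideanSpace ℝ d)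
    (h : Torus.IsLerayHopfOn T ν (fun t y => f (y + proj (t • W))) u₀ u) (hT : 0 < T)
    (hf : IsSmooth f) (hf0 : HasZeroMean f) (V : EuclideanSpace ℝ d) {t : ℝ} (ht : t ∈ Ioc 0 T) :
    ⟪∫ y, u t y, V⟫ = ∫ y, ⟪u₀ y, V⟫ := by
  have hti : Integrable (u t) volume := (h.memLp t (Ioc_subset_Icc_self ht)).integrable one_le_two
  rw [inner_integral_left_eq_integral_inner hti V,
    h.integral_inner_const_eq hT (aestronglyMeasurable_stLift_swept hf.continuous W _)
      (lintegral_Ioo_lintegral_enorm_sq_swept_lt_top (hf.memLp 2) W T) V ht]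
  have h0 : ∀ s : ℝ, ∫ x, ⟪f (x + proj (s • W)), V⟫ = 0 := fun s =>
    integral_inner_comp_add_right_const_eq_zero hf.integrable hf0 _ V
  simp [h0]

/-- **The work is frame independent**, swept force:
`∫ₛᵗ ∫ ⟪f (· + [τ(W + V)]), u τ (· + [τV]) − V⟫ dτ = ∫ₛᵗ ∫ ⟪f (· + [τW]), u τ⟫ dτ`, `0 ≤ s ≤ t ≤ T`. [folklore] -/
theorem intervalIntegral_work_swept (W : EuclideanSpace ℝ d)
    (h : Torus.IsLerayHopfOn T ν (fun t y => f (y + proj (t • W))) u₀ u)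
    (hf : IsSmooth f) (hf0 : HasZeroMean f) (V : EuclideanSpace ℝ d) {s t : ℝ} (hs : 0 ≤ s)
    (hst : s ≤ t) (ht : t ≤ T) :
    ∫ τ in s..t, ∫ y, ⟪f (y + proj (τ • (W + V))), u τ (y + proj (τ • V)) - V⟫ =
      ∫ τ in s..t, ∫ y, ⟪f (y + proj (τ • W)), u τ y⟫ := by
  refine intervalIntegral.integral_congr fun τ hτ => ?_
  rw [uIcc_of_le hst] at hτ
  have e := integral_inner_comp_add_right_sub_const (g := fun x => f (x + proj (τ • W)))
    ((hf.comp_add_right _).memLp 2) (hasZeroMean_comp_add_right hf0 _)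
    (h.memLp τ ⟨hs.trans hτ.1, hτ.2.trans ht⟩) (proj (τ • V)) V
  simpa only [comp_add_proj_smul_add_proj_smul] using e

/-- **Energy inequality in the moving frame from `s = 0`**, swept force, for a solution normalised to
`u 0 = u₀`: both sides move by the constant `-⟪∫ u₀, V⟫ + ½‖V‖²` (conserved momentum; frame-independent
dissipation and work). [folklore] -/
theorem galilean_energy_ineq_zero_swept (W : EuclideanSpace ℝ d)
    (h : Torus.IsLerayHopfOn T ν (fun t y => f (y + proj (t • W))) u₀ u) (hT : 0 < T)
    (hf : IsSmooth f) (hf0 : HasZeroMean f) (h0 : u 0 = u₀) (V : EuclideanSpace ℝ d) :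
    ∀ t ∈ Icc 0 T,
      kineticEnergy (fun y => u t (y + proj (t • V)) - V) +
          ν * (∫⁻ τ in Ioo 0 t, eGradNormSq (fun y => u τ (y + proj (τ • V)) - V)).toReal ≤
        kineticEnergy (fun y => u₀ y - V) +
          ∫ τ in (0 : ℝ)..t, ∫ y, ⟪f (y + proj (τ • (W + V))), u τ (y + proj (τ • V)) - V⟫ := by
  intro t ht
  have hu₀ : MemLp u₀ 2 volume := h0 ▸ h.memLp 0 ⟨le_rfl, hT.le⟩
  have hE : kineticEnergy (u t) + ν * (∫⁻ τ in Ioo 0 t, eGradNormSq (u τ)).toReal ≤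
      kineticEnergy u₀ + ∫ τ in (0 : ℝ)..t, ∫ y, ⟪f (y + proj (τ • W)), u τ y⟫ := h.energy_ineq_zero t ht
  have hK0 : kineticEnergy (fun y => u₀ y - V) = kineticEnergy u₀ - ⟪∫ y, u₀ y, V⟫ + 2⁻¹ * ‖V‖ ^ 2 := by
    have e := kineticEnergy_comp_add_right_sub_const hu₀ 0 V
    simp only [add_zero] at e
    exact e
  have hm : ⟪∫ y, u t y, V⟫ = ⟪∫ y, u₀ y, V⟫ := by
    rcases ht.1.eq_or_lt with h00 | htpos
    · rw [← h00, h0]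
    · rw [inner_integral_eq_of_swept W h hT hf hf0 V ⟨htpos, ht.2⟩,
        inner_integral_left_eq_integral_inner (hu₀.integrable one_le_two) V]
  rw [kineticEnergy_comp_add_right_sub_const (h.memLp t ht),
    setLIntegral_eGradNormSq_galilean_anyForce h V le_rfl ht.2,
    intervalIntegral_work_swept W h hf hf0 V le_rfl ht.1 ht.2, hK0, hm]
  linarith

/-- **Energy inequality in the moving frame from a.e. `s ∈ (0, T)`**, swept force: both sides move by
`-⟪∫ u s, V⟫ + ½‖V‖²`, `⟪∫ u t, V⟫ = ⟪∫ u s, V⟫` by momentum conservation. [folklore] -/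
theorem galilean_energy_ineq_ae_swept (W : EuclideanSpace ℝ d)
    (h : Torus.IsLerayHopfOn T ν (fun t y => f (y + proj (t • W))) u₀ u) (hT : 0 < T)
    (hf : IsSmooth f) (hf0 : HasZeroMean f) (V : EuclideanSpace ℝ d) :
    ∀ᵐ s ∂(volume.restrict (Ioo 0 T)), ∀ t ∈ Icc s T,
      kineticEnergy (fun y => u t (y + proj (t • V)) - V) +
          ν * (∫⁻ τ in Ioo s t, eGradNormSq (fun y => u τ (y + proj (τ • V)) - V)).toReal ≤
        kineticEnergy (fun y => u s (y + proj (s • V)) - V) +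
          ∫ τ in s..t, ∫ y, ⟪f (y + proj (τ • (W + V))), u τ (y + proj (τ • V)) - V⟫ := by
  filter_upwards [h.energy_ineq_ae, ae_restrict_mem measurableSet_Ioo] with s hs hsI t hst
  have hsT : s ∈ Icc 0 T := ⟨hsI.1.le, hsI.2.le⟩
  have htT : t ∈ Icc 0 T := ⟨hsI.1.le.trans hst.1, hst.2⟩
  have hE : kineticEnergy (u t) + ν * (∫⁻ τ in Ioo s t, eGradNormSq (u τ)).toReal ≤
      kineticEnergy (u s) + ∫ τ in s..t, ∫ y, ⟪f (y + proj (τ • W)), u τ y⟫ := hs t hst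
  rw [kineticEnergy_comp_add_right_sub_const (h.memLp t htT),
    kineticEnergy_comp_add_right_sub_const (h.memLp s hsT),
    setLIntegral_eGradNormSq_galilean_anyForce h V hsI.1.le hst.2,
    intervalIntegral_work_swept W h hf hf0 V hsI.1.le hst.1 hst.2,
    inner_integral_eq_of_swept W h hT hf hf0 V ⟨hsI.1.trans_le hst.1, hst.2⟩,
    inner_integral_eq_of_swept W h hT hf hf0 V ⟨hsI.1, hsI.2.le⟩]
  linarith

/-! ### Assembly -/

/-- **Galilean covariance of Leray–Hopf solutions on `T^d × [0, T)`, uniformly swept force** (smooth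
zero-mean pattern `f` swept at `W`, time-zero slice normalised to the datum): `(t, y) ↦ u t (y + [tV]) − V` is a
Leray–Hopf solution driven by `f` swept at `W + V`, from the datum `u₀ − V`. [cite: Frisch1995, §2.2] -/
theorem isLerayHopfOn_galilean_swept (W : EuclideanSpace ℝ d)
    (h : Torus.IsLerayHopfOn T ν (fun t y => f (y + proj (t • W))) u₀ u) (hT : 0 < T)
    (hf : IsSmooth f) (hf0 : HasZeroMean f) (h0 : u 0 = u₀) (V : EuclideanSpace ℝ d) :
    Torus.IsLerayHopfOn T ν (fun t y => f (y + proj (t • (W + V)))) (fun y => u₀ y - V)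
      (fun t y => u t (y + proj (t • V)) - V) := by
  have hu₀ : MemLp u₀ 2 volume := h0 ▸ h.memLp 0 ⟨le_rfl, hT.le⟩
  have ha : Continuous fun t : ℝ => proj (t • V) := continuous_proj.comp (continuous_id.smul continuous_const)
  have ha0 : proj ((0 : ℝ) • V) = 0 := by rw [zero_smul, proj_zero]
  exact
    { weak := isWeakNSSolutionForcedOn_galilean_swept W h.weak hf (hu₀.integrable one_le_two) V
      energy_bound := galilean_energy_bound_anyForce h V
      memLp := galilean_memLp_anyForce h V
      memL2Sobolev := galilean_memL2Sobolev_anyForce h V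
      energy_ineq_zero := galilean_energy_ineq_zero_swept W h hT hf hf0 h0 V
      energy_ineq_ae := galilean_energy_ineq_ae_swept W h hT hf hf0 V
      weak_continuous := fun w hw => h.weak_continuous_comp_add_path (a := fun t => proj (t • V)) hT hu₀ ha ha0 V w hw
      strong_initial := h.strong_initial_comp_add_path (a := fun t => proj (t • V)) hu₀ ha ha0 V }

/-- **Galilean covariance of global Leray–Hopf solutions on `T^d`, uniformly swept force** (`u 0 = u₀`).
[cite: Frisch1995, §2.2] -/
theorem isGlobalLerayHopf_galilean_swept (W : EuclideanSpace ℝ d)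
    (h : Torus.IsGlobalLerayHopf ν (fun t y => f (y + proj (t • W))) u₀ u)
    (hf : IsSmooth f) (hf0 : HasZeroMean f) (h0 : u 0 = u₀) (V : EuclideanSpace ℝ d) :
    Torus.IsGlobalLerayHopf ν (fun t y => f (y + proj (t • (W + V)))) (fun y => u₀ y - V)
      (fun t y => u t (y + proj (t • V)) - V) :=
  fun T hT => isLerayHopfOn_galilean_swept W (h T hT) hT hf hf0 h0 V

/-- **Back to the steady frame.** A global Leray–Hopf solution with `L²` datum driven by the pattern `f` swept
at `c` becomes, in the frame moving with `-c` (after normalising the time-zero slice), a global Leray–Hopf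
solution driven by the STEADY force `f`: `(t, x) ↦ u t (x − [tc]) + c` from the datum `u₀ + c`.
[cite: Frisch1995, §2.2] -/
theorem isGlobalLerayHopf_unsweep (c : EuclideanSpace ℝ d)
    (h : Torus.IsGlobalLerayHopf ν (fun t y => f (y + proj (t • c))) u₀ u)
    (hf : IsSmooth f) (hf0 : HasZeroMean f) (hu₀ : MemLp u₀ 2 volume) :
    Torus.IsGlobalLerayHopf ν (fun _ => f) (fun y => u₀ y - -c)
      (fun t y => Function.update u 0 u₀ t (y + proj (t • -c)) - -c) := by
  have hB := isGlobalLerayHopf_galilean_swept c (h.update_zero hu₀) hf hf0 (Function.update_self 0 u₀ u) (-c)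
  have hF : (fun (t : ℝ) (y : UnitAddTorus d) => f (y + proj (t • (c + -c)))) = fun _ => f := by
    funext t y
    rw [add_neg_cancel, smul_zero, proj_zero, add_zero]
  rwa [hF] at hB

end Swept

end Summit.AnomalousDissipation.AnomalousDissipation.Theorems

end
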